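import Mathlib
import Literature.NumberTheory.LFunctions.Zhang2022.Section16Eval1617
import Literature.NumberTheory.LFunctions.Zhang2022.Section16Endgame
import Literature.NumberTheory.LFunctions.Zhang2022.Section16Eq162Edge
import Literature.NumberTheory.LFunctions.Zhang2022.Section16ResidueDischarge
import Literature.NumberTheory.LFunctions.Zhang2022.TypedSection16B
import Literature.NumberTheory.LFunctions.Zhang2022.SkeletonEvalRel
import HarnessLib

/-!
# Zhang (2022), §16 p. 95 in the RELATIVE reading: `(16.12) + (16.16) + u044 ⇒ Φ₂(p) = −(𝔢₁+𝔢₂)𝔞p + o((𝔞+1)p)`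
# and `(16.2) + that ⇒ (16.17)ᴿ = Skeleton.Eval1617Rel` — WITHOUT the extra input `𝔞 = o(𝓛)`

Topic `Literature/NumberTheory/LFunctions/Zhang2022` (Landau–Siegel audit tree; verdict-neutral).
Y. Zhang, *Discrete mean estimates and the Landau–Siegel zero*, arXiv:2211.02515v1 (2022)
[Zhang2022LandauSiegel] — **an unrefereed manuscript under adjudication**; the displays referred to are
CLAIM nodes (`Typed.Section16A`, `Typed.Section16B`, `SkeletonPartThree`), stated not asserted.

The absolute §16 endgame of the tree (`Skeleton.phi2p_eval_of_parts`, `Section16Endgame`; GAP-LEDGER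
row G-d49-1) needs ONE input the manuscript does not supply, `𝔞 = o(𝓛)` under (A): the relative error
`O(𝓛⁻¹)` of `𝓡₂*𝓡₂ⱼ` against the main term `𝔞𝔢ⱼ(φ(D)/D)L′(1,χ)` of (16.16) leaves `O(𝓛⁻¹𝔞p)`, which is
`o(p)` iff `𝔞 = o(𝓛)`. But the composition §2 p. 6 consumes (16.17) only in its RELATIVE form
`Skeleton.Eval1617Rel c′` (`‖Φ₂ − (𝔢₁+𝔢₂)𝔞𝔓‖ ≤ ε(𝔞+1)𝔓`, `SkeletonEvalRel.eval181Rel_of_parts`), and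
`O(𝓛⁻¹𝔞p)` IS `o((𝔞+1)p)` with no size input on `𝔞` at all (row G-d49-1, disposition (b), localised to
§16: nothing else in the chain changes). This file proves exactly that:

* `phi2p_evalRel_of_parts` — `Skeleton.endgame_core` run with `η := 𝔞/𝓛` (so its size hypothesis
  `𝔞 ≤ η𝓛` holds trivially): from (16.12), (16.16), the `𝓡₂*𝓡₂ⱼ` display u044 and Lemma 5.7 of the tree,
  `‖Φ₂(p) + (𝔢₁+𝔢₂)𝔞p‖ ≤ ε(𝔞+1)p` uniformly for `p ∼ P`, for all large `D` — NO `hsmall`;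
* `eval1617Rel_of_parts` — the relative twin of `Skeleton.eval1617_of_parts`: (16.2) + the display above
  ⇒ `Eval1617Rel c′` (same exact identity; "`(pt₀)^{β₁} = −1 + O(α₁)`" is
  `norm_primeWindow_cpow_beta1_add_one_le`, the `O(α₁𝔞𝔓)` term is absorbed by `frakA_le` as before);
* on the typed nodes: `step16_u045Rel_of` ((16.12) + (16.16) ⇒ relative u045, u044 being the tree theorem
  `ResidueValues.step16_u044_holds`) and the composed edge
  `eval1617Rel_of_leaves : Prop141 → Step16_u010 c′ → Eq16_12 c′ → Eq16_16 c′ → Eval1617Rel c′` —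
  the §16 frontier WITHOUT the binder `hAsmall` of `Skeleton.eval1617_of_leaves`.

What is NOT asserted: (16.2)/(16.12)/(16.16)/u010/Prop. 14.1 (CLAIM nodes); the absolute (16.17)
`Eval1617 c′` (which does need a size input); anything about Theorems 1–2 of the source; nothing here
bears on the cell's verdict on (8.24) / `Margin232`.

## References

* Y. Zhang, arXiv:2211.02515v1 (2022), §16 (16.2), (16.12), (16.16), (16.17), p. 95; §5 Lemma 5.7;
  §2 (2.13), (2.31). [cite: Zhang2022LandauSiegel, §16 p.95]
-/

noncomputable section

open Complex Real

namespace Literature.NumberTheory.LFunctions.Zhang2022.Skeleton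

/-! ## The endgame with a relative error: no size input on `𝔞` -/

/-- **§16 p. 95, "This together with (16.16) and (16.12) yields `Φ₂(p) = −(𝔢₁+𝔢₂)𝔞p + o(p)`" in the
RELATIVE reading** (DAG `Z22:§16.u045` ⇐ `Z22:(16.12)` + `Z22:(16.16)` + `Z22:§16.u044`): for ANY
`Φ₂(p)`, `𝓡₂*`, `𝓡₂ⱼ`, `𝒮₂ⱼ`, from the three displays as typed and Lemma 5.7 of the tree,
`‖Φ₂(p) + (𝔢₁+𝔢₂)𝔞p‖ ≤ ε(𝔞+1)p` uniformly for `p ∼ P`, for all large `D` under (A) — with NO hypothesis on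
the size of `𝔞` (`Skeleton.endgame_core` at `η := 𝔞/𝓛`: the residual `(ε₁ + 8e(C₁C₂+C₁)𝓛⁻¹)p +
C₂(|𝔢₁|+|𝔢₂|)𝓛⁻¹·𝔞p` is `≤ ε(𝔞+1)p` once `𝓛` is large). [cite: Zhang2022LandauSiegel, §16 p.95] -/
theorem phi2p_evalRel_of_parts
    (Φ : (D : ℕ) → [NeZero D] → DirichletCharacter ℂ D → ℕ → ℂ)
    (Rs : (D : ℕ) → [NeZero D] → DirichletCharacter ℂ D → ℂ)
    (R S : (D : ℕ) → [NeZero D] → DirichletCharacter ℂ D → ℕ → ℂ)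
    (h1612 : ∀ ε : ℝ, 0 < ε → ForAllLarge fun D _ χ => AssumptionA D χ → ∀ p ∈ primeWindow D,
      ‖Φ D χ p - Rs D χ * ((D : ℝ) * p : ℝ) / (Nat.totient D : ℂ) *
        ∑ j ∈ ({1, 2} : Finset ℕ), R D χ j * S D χ j‖ ≤ ε * p)
    (h1616 : ∃ C : ℝ, ForAllLarge fun D _ χ => AssumptionA D χ → ∀ j ∈ ({1, 2} : Finset ℕ),
      ‖S D χ j - (frakA χ : ℂ) * frake j * ((Nat.totient D : ℂ) / (D : ℂ)) * deriv χ.LFunction 1‖ ≤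
        C * (ell D ^ 4)⁻¹)
    (h44 : ∃ C : ℝ, ForAllLarge fun D _ χ => AssumptionA D χ → ∀ j ∈ ({1, 2} : Finset ℕ),
      ‖Rs D χ * R D χ j + 1 / deriv χ.LFunction 1‖ ≤ C * (ell D)⁻¹ * ‖deriv χ.LFunction 1‖⁻¹) :
    ∀ ε : ℝ, 0 < ε → ForAllLarge fun D _ χ => AssumptionA D χ → ∀ p ∈ primeWindow D,
      ‖Φ D χ p + (frake 1 + frake 2) * frakA χ * p‖ ≤ ε * (frakA χ + 1) * p := by
  intro ε hε
  obtain ⟨C₁, hC₁⟩ := h1616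
  obtain ⟨C₂, hC₂⟩ := h44
  set C₁' : ℝ := max C₁ 0 with hC₁'
  set C₂' : ℝ := max C₂ 0 with hC₂'
  have hC₁'0 : 0 ≤ C₁' := le_max_right _ _
  have hC₂'0 : 0 ≤ C₂' := le_max_right _ _
  set E : ℝ := ‖frake 1‖ + ‖frake 2‖ with hE
  have hE0 : 0 ≤ E := by positivity
  have hε3 : 0 < ε / 3 := by positivity
  set K : ℝ := C₁' * C₂' + C₁' with hK
  have hK0 : 0 ≤ K := by positivity
  obtain ⟨Dl, hDl⟩ := self_div_totient_le_norm_deriv_L_one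
  obtain ⟨D₁, h₁⟩ := ((h1612 _ hε3).and hC₁).and hC₂
  obtain ⟨D₂, h₂⟩ := exists_forall_le_ell (max 1 ((24 * Real.exp 1 * K + 3 * (C₂' * E)) / ε))
  refine ⟨max (max D₁ D₂) Dl, fun D _ χ hD hq hp hA p hpW => ?_⟩
  have hD1 : D₁ ≤ D := le_trans (le_trans (le_max_left _ _) (le_max_left _ _)) hD
  have hD2 : D₂ ≤ D := le_trans (le_trans (le_max_right _ _) (le_max_left _ _)) hD
  have hDl' : Dl ≤ D := le_trans (le_max_right _ _) hD
  obtain ⟨⟨e12, e16⟩, e44⟩ := h₁ D χ hD1 hq hp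
  have hM := h₂ D hD2
  have hℓ1 : 1 ≤ ell D := le_trans (le_max_left _ _) hM
  have hℓK : (24 * Real.exp 1 * K + 3 * (C₂' * E)) / ε ≤ ell D := le_trans (le_max_right _ _) hM
  have hℓ0 : 0 < ell D := by linarith
  have hLge := hDl D χ hDl' hq hp hA
  -- `L′(1,χ) ≠ 0`
  have hρpos : 0 < (D : ℝ) / Nat.totient D := by
    have := NeZero.pos D
    have hφ := Nat.totient_pos.mpr this
    positivity
  have hL0 : deriv χ.LFunction 1 ≠ 0 := by
    intro h
    rw [h, norm_zero, mul_zero] at hLge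
    linarith
  have h1mem : (1 : ℕ) ∈ ({1, 2} : Finset ℕ) := by simp
  have h2mem : (2 : ℕ) ∈ ({1, 2} : Finset ℕ) := by simp
  -- the inputs at this `D, χ, p`
  have g12 := e12 hA p hpW
  rw [Finset.sum_pair (by norm_num : (1 : ℕ) ≠ 2)] at g12
  have hx4 : 0 ≤ (ell D ^ 4)⁻¹ := by positivity
  have g16₁ : ‖S D χ 1 - (frakA χ : ℂ) * frake 1 * ((Nat.totient D : ℂ) / (D : ℂ)) *
      deriv χ.LFunction 1‖ ≤ C₁' * (ell D ^ 4)⁻¹ :=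
    (e16 hA 1 h1mem).trans (mul_le_mul_of_nonneg_right (le_max_left _ _) hx4)
  have g16₂ : ‖S D χ 2 - (frakA χ : ℂ) * frake 2 * ((Nat.totient D : ℂ) / (D : ℂ)) *
      deriv χ.LFunction 1‖ ≤ C₁' * (ell D ^ 4)⁻¹ :=
    (e16 hA 2 h2mem).trans (mul_le_mul_of_nonneg_right (le_max_left _ _) hx4)
  have hy : 0 ≤ (ell D)⁻¹ * ‖deriv χ.LFunction 1‖⁻¹ := by positivity
  have g44₁ : ‖Rs D χ * R D χ 1 + 1 / deriv χ.LFunction 1‖ ≤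
      C₂' * (ell D)⁻¹ * ‖deriv χ.LFunction 1‖⁻¹ := by
    refine (e44 hA 1 h1mem).trans ?_
    rw [mul_assoc, mul_assoc]
    exact mul_le_mul_of_nonneg_right (le_max_left _ _) hy
  have g44₂ : ‖Rs D χ * R D χ 2 + 1 / deriv χ.LFunction 1‖ ≤
      C₂' * (ell D)⁻¹ * ‖deriv χ.LFunction 1‖⁻¹ := by
    refine (e44 hA 2 h2mem).trans ?_
    rw [mul_assoc, mul_assoc]
    exact mul_le_mul_of_nonneg_right (le_max_left _ _) hy
  -- `η := 𝔞/𝓛`, so that `𝔞 ≤ η𝓛` holds with equality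
  have hA0 : 0 ≤ frakA χ := frakA_nonneg χ
  set η : ℝ := frakA χ / ell D with hη
  have haη : frakA χ ≤ η * ell D := by
    rw [hη, div_mul_cancel₀ _ hℓ0.ne']
  have key := endgame_core (Φ := Φ D χ p) (Rs := Rs D χ) (e₁ := frake 1) (e₂ := frake 2) hL0
    (Nat.totient_pos.mpr (NeZero.pos D)) (NeZero.pos D) hA0 hC₁'0 hC₂'0 hℓ1 hLge
    haη g12 g16₁ g16₂ g44₁ g44₂
  refine key.trans ?_
  have hp0 : (0 : ℝ) ≤ p := Nat.cast_nonneg p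
  -- `ε/3 + 8eK𝓛⁻¹ + C₂'E·𝔞/𝓛 ≤ ε(𝔞+1)`: from `(24eK + 3C₂'E)/ε ≤ 𝓛`
  have hℓK' : 24 * Real.exp 1 * K + 3 * (C₂' * E) ≤ ell D * ε := by
    rwa [div_le_iff₀ hε] at hℓK
  have hCE : 0 ≤ C₂' * E := mul_nonneg hC₂'0 hE0
  have heK : 0 ≤ Real.exp 1 * K := mul_nonneg (Real.exp_pos 1).le hK0
  have hmid : 8 * Real.exp 1 * (C₁' * C₂' + C₁') * (ell D)⁻¹ ≤ ε / 3 := by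
    rw [← hK, ← div_eq_mul_inv, div_le_iff₀ hℓ0]
    linarith
  have h1 : C₂' * E ≤ ε / 3 * ell D := by linarith
  have h2 : C₂' * E * frakA χ ≤ ε / 3 * ell D * frakA χ := mul_le_mul_of_nonneg_right h1 hA0
  have hlast : C₂' * (‖frake 1‖ + ‖frake 2‖) * η ≤ ε / 3 * frakA χ := by
    rw [← hE, hη, mul_div_assoc', div_le_iff₀ hℓ0]
    linarith
  have hεA : 0 ≤ ε * frakA χ := mul_nonneg hε.le hA0
  have hsum : ε / 3 + 8 * Real.exp 1 * (C₁' * C₂' + C₁') * (ell D)⁻¹ +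
      C₂' * (‖frake 1‖ + ‖frake 2‖) * η ≤ ε * (frakA χ + 1) := by
    linarith
  exact mul_le_mul_of_nonneg_right hsum hp0

/-! ## `(16.2) + Φ₂(p)-evaluation (relative) ⇒ (16.17)ᴿ` -/

/-- **(16.17)ᴿ from (16.2) and the relative evaluation of `Φ₂(p)`** (§16 p. 95, tex L4680–L4687; DAG
`Z22:(16.17)` ⇐ `Z22:(16.2)` + `Z22:§16.u045`): for ANY `Φ₂(p)`, if "`Φ₂ = Σ_{p∼P}(pt₀)^{β₁}Φ₂(p) + o(𝔓)`"
(16.2) and `‖Φ₂(p) + (𝔢₁+𝔢₂)𝔞p‖ ≤ ε(𝔞+1)p` uniformly for `p ∼ P`, then `Skeleton.Eval1617Rel c′`: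
`‖Φ₂ − (𝔢₁+𝔢₂)𝔞𝔓‖ ≤ ε(𝔞+1)𝔓`. Same exact identity as `Skeleton.eval1617_of_parts`; "`(pt₀)^{β₁} = −1 +
O(α₁)`" is `norm_primeWindow_cpow_beta1_add_one_le` and `O(α₁𝔞𝔓) = o(𝔓)` is `frakA_le`.
[cite: Zhang2022LandauSiegel, §16 (16.17)] -/
theorem eval1617Rel_of_parts (c' : ℝ) (Φ : (D : ℕ) → [NeZero D] → DirichletCharacter ℂ D → ℕ → ℂ)
    (h162 : ∀ ε : ℝ, 0 < ε → ForAllLarge fun D _ χ => AssumptionA D χ →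
      ‖Phi2 c' χ - ∑ p ∈ primeWindow D, (((p : ℝ) * t0 D : ℝ) : ℂ) ^ beta1 c' D * Φ D χ p‖ ≤
        ε * frakP D)
    (hΦ : ∀ ε : ℝ, 0 < ε → ForAllLarge fun D _ χ => AssumptionA D χ → ∀ p ∈ primeWindow D,
      ‖Φ D χ p + (frake 1 + frake 2) * frakA χ * p‖ ≤ ε * (frakA χ + 1) * p) :
    Eval1617Rel c' := by
  intro ε hε
  set E : ℂ := frake 1 + frake 2 with hE
  have hε3 : 0 < ε / 3 := by positivity
  obtain ⟨D₁, h₁⟩ := (h162 _ hε3).and (hΦ _ hε3)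
  -- the constant of the third error term and the threshold on `𝓛`
  set K : ℝ := (523 + 2635 * |c'|) * ‖E‖ * (16 * Real.exp 9) * π with hK
  have hK0 : 0 ≤ K := by positivity
  obtain ⟨D₂, h₂⟩ := exists_forall_le_ell (max 3 (3 * K / ε + 1))
  refine ⟨max D₁ D₂, fun D _ χ hD hq hp hA => ?_⟩
  obtain ⟨e162, eΦ⟩ := h₁ D χ (le_trans (le_max_left _ _) hD) hq hp
  replace e162 := e162 hA
  replace eΦ := eΦ hA
  have hM := h₂ D (le_trans (le_max_right _ _) hD)
  have hℓ3 : 3 ≤ ell D := le_trans (le_max_left _ _) hM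
  have hℓK : 3 * K / ε + 1 ≤ ell D := le_trans (le_max_right _ _) hM
  have hℓ0 : 0 < ell D := by linarith
  have hℓ1 : 1 ≤ ell D := by linarith
  -- `K/𝓛⁴ ≤ ε/3`
  have hℓ4 : 3 * K / ε ≤ ell D ^ 4 := by
    have : ell D ≤ ell D ^ 4 := le_self_pow₀ hℓ1 (by norm_num)
    linarith
  have hKε : K / ell D ^ 4 ≤ ε / 3 := by
    rw [div_le_iff₀ (by positivity)]
    have : 3 * K ≤ ell D ^ 4 * ε := by rwa [div_le_iff₀ hε] at hℓ4
    linarith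
  -- the two inputs on the window
  have hα5 : alpha D * ell D * ell D ^ 4 = π / ell D ^ 4 := by
    have h9 := alpha_mul_ell_pow_nine (D := D) hℓ0
    field_simp
    linear_combination h9
  have hα : 0 < alpha D := alpha_pos_of_ell_pos hℓ0
  have hAle : frakA χ ≤ 16 * Real.exp 9 * ell D ^ 4 := frakA_le χ hℓ3 hp
  have hA0 : 0 ≤ frakA χ := frakA_nonneg χ
  have hA1 : 1 ≤ frakA χ + 1 := by linarith
  -- abbreviation for the weights
  set w : ℕ → ℂ := fun p => (((p : ℝ) * t0 D : ℝ) : ℂ) ^ beta1 c' D with hw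
  have hw1 : ∀ p ∈ primeWindow D, ‖w p‖ = 1 := fun p hp' =>
    norm_primeWindow_cpow_beta1 c' hℓ0 hp'
  have hw2 : ∀ p ∈ primeWindow D, ‖w p + 1‖ ≤ (523 + 2635 * |c'|) * (alpha D * ell D) :=
    fun p hp' => norm_primeWindow_cpow_beta1_add_one_le c' hℓ3 hp'
  -- `𝔓 = Σ_{p∼P} p`
  have hP : (frakP D : ℂ) = ∑ p ∈ primeWindow D, (p : ℂ) := by
    rw [frakP_eq_sum_primeWindow]; push_cast; rfl
  -- the exact decomposition
  have hsum : ∑ p ∈ primeWindow D, w p * (Φ D χ p + E * frakA χ * p) -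
      ∑ p ∈ primeWindow D, (w p + 1) * (E * frakA χ * p) =
      ∑ p ∈ primeWindow D, w p * Φ D χ p - ∑ p ∈ primeWindow D, E * frakA χ * p := by
    rw [← Finset.sum_sub_distrib, ← Finset.sum_sub_distrib]
    exact Finset.sum_congr rfl fun p _ => by ring
  have key : Phi2 c' χ - E * frakA χ * frakP D =
      (Phi2 c' χ - ∑ p ∈ primeWindow D, w p * Φ D χ p) +
      (∑ p ∈ primeWindow D, w p * (Φ D χ p + E * frakA χ * p) -
        ∑ p ∈ primeWindow D, (w p + 1) * (E * frakA χ * p)) := by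
    rw [hsum, hP, Finset.mul_sum]; ring
  -- termwise bounds
  have hB : ∀ p ∈ primeWindow D, ‖w p * (Φ D χ p + E * frakA χ * p)‖ ≤
      ε / 3 * (frakA χ + 1) * p := by
    intro p hp'
    rw [norm_mul, hw1 p hp', one_mul]
    exact eΦ p hp'
  have hC : ∀ p ∈ primeWindow D, ‖(w p + 1) * (E * frakA χ * p)‖ ≤ K / ell D ^ 4 * p := by
    intro p hp'
    have hn : ‖(E * frakA χ * p : ℂ)‖ = ‖E‖ * frakA χ * p := by
      rw [norm_mul, norm_mul, Complex.norm_real, Real.norm_of_nonneg hA0, Complex.norm_natCast]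
    rw [norm_mul, hn]
    calc ‖w p + 1‖ * (‖E‖ * frakA χ * p)
        ≤ (523 + 2635 * |c'|) * (alpha D * ell D) * (‖E‖ * (16 * Real.exp 9 * ell D ^ 4) * p) :=
          mul_le_mul (hw2 p hp') (by gcongr)
            (mul_nonneg (mul_nonneg (norm_nonneg _) hA0) (Nat.cast_nonneg _))
            (mul_nonneg (by positivity) (mul_pos hα hℓ0).le)
      _ = K / ell D ^ 4 * p := by
          rw [hK]
          have : (523 + 2635 * |c'|) * (alpha D * ell D) *
              (‖E‖ * (16 * Real.exp 9 * ell D ^ 4) * (p : ℝ)) =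
              (523 + 2635 * |c'|) * ‖E‖ * (16 * Real.exp 9) *
                (alpha D * ell D * ell D ^ 4) * p := by ring
          rw [this, hα5]; ring
  have hC' : ∀ p ∈ primeWindow D, ‖(w p + 1) * (E * frakA χ * p)‖ ≤ ε / 3 * p := fun p hp' =>
    (hC p hp').trans (mul_le_mul_of_nonneg_right hKε (Nat.cast_nonneg p))
  -- sum up
  have hPnn : 0 ≤ frakP D := frakP_nonneg D
  rw [key]
  calc ‖(Phi2 c' χ - ∑ p ∈ primeWindow D, w p * Φ D χ p) +
        (∑ p ∈ primeWindow D, w p * (Φ D χ p + E * frakA χ * p) -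
          ∑ p ∈ primeWindow D, (w p + 1) * (E * frakA χ * p))‖
      ≤ ‖Phi2 c' χ - ∑ p ∈ primeWindow D, w p * Φ D χ p‖ +
        (‖∑ p ∈ primeWindow D, w p * (Φ D χ p + E * frakA χ * p)‖ +
          ‖∑ p ∈ primeWindow D, (w p + 1) * (E * frakA χ * p)‖) :=
        (norm_add_le _ _).trans (by gcongr; exact norm_sub_le _ _)
    _ ≤ ε / 3 * frakP D + (∑ p ∈ primeWindow D, ε / 3 * (frakA χ + 1) * (p : ℝ) +
          ∑ p ∈ primeWindow D, ε / 3 * (p : ℝ)) :=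
        add_le_add e162 (add_le_add ((norm_sum_le _ _).trans (Finset.sum_le_sum hB))
          ((norm_sum_le _ _).trans (Finset.sum_le_sum hC')))
    _ = (ε / 3 + ε / 3 * (frakA χ + 1) + ε / 3) * frakP D := by
        rw [← Finset.mul_sum, ← Finset.mul_sum, frakP_eq_sum_primeWindow]; ring
    _ ≤ (ε * (frakA χ + 1)) * frakP D := by
        apply mul_le_mul_of_nonneg_right _ hPnn
        have hthird : ε / 3 ≤ ε / 3 * (frakA χ + 1) := le_mul_of_one_le_right hε3.le hA1
        linarith
    _ = ε * (frakA χ + 1) * frakP D := by ring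

/-! ## On the typed nodes -/

/-- **u045 in the relative reading from (16.12) and (16.16) ALONE** (the `𝓡₂*𝓡₂ⱼ` display u044 being
the tree theorem `ResidueValues.step16_u044_holds`), NO size input on `𝔞`: for all large `D` under (A),
`‖Φ₂(p) + (𝔢₁+𝔢₂)𝔞p‖ ≤ ε(𝔞+1)p` for `p ∼ P`. [cite: Zhang2022LandauSiegel, §16 p.95] -/
theorem step16_u045Rel_of (c' : ℝ) (h1612 : Typed.Section16A.Eq16_12 c')
    (h1616 : Typed.Section16B.Eq16_16 c') :
    ∀ ε : ℝ, 0 < ε → ForAllLarge fun D _ χ => AssumptionA D χ → ∀ p ∈ primeWindow D,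
      ‖Typed.Section16A.Phi2p c' χ p + (frake 1 + frake 2) * frakA χ * p‖ ≤ ε * (frakA χ + 1) * p :=
  phi2p_evalRel_of_parts (fun _ _ χ p => Typed.Section16A.Phi2p c' χ p)
    (fun _ _ χ => Typed.Section16A.calR2star c' χ) (fun _ _ χ j => Typed.Section16A.calR2 c' χ j)
    (fun _ _ χ j => Typed.Section16A.calS2 c' χ j) h1612 h1616 (ResidueValues.step16_u044_holds c')

/-- **The §16 path of the composition WITHOUT `𝔞 = o(𝓛)`**: Proposition 14.1 + u010 + (16.12) + (16.16)
⇒ (16.17)ᴿ = `Skeleton.Eval1617Rel c′` ((16.2) ⇐ Prop. 14.1 + u010 is `Skeleton.eq16_2_of_prop141`;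
u043/u044 are tree theorems; the in-line `(pt₀)^{β₁}` claim is proved). Compare
`Skeleton.eval1617_of_leaves` (absolute (16.17), one more hypothesis `hsmall : 𝔞 = o(𝓛)`, GAP row
G-d49-1): the relative form needed downstream (`eval181Rel_of_parts`) carries no such hypothesis.
[cite: Zhang2022LandauSiegel, §16 (16.17) p.95] -/
theorem eval1617Rel_of_leaves (c' : ℝ) (h141 : Prop141) (h010 : Typed.Section16A.Step16_u010 c')
    (h1612 : Typed.Section16A.Eq16_12 c') (h1616 : Typed.Section16B.Eq16_16 c') :
    Eval1617Rel c' :=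
  eval1617Rel_of_parts c' (fun _ _ χ p => Typed.Section16A.Phi2p c' χ p)
    (eq16_2_of_prop141 c' h141 h010) (step16_u045Rel_of c' h1612 h1616)

end Literature.NumberTheory.LFunctions.Zhang2022.Skeleton
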